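/-
Copyright (c) 2026 the pub-hodgecm-mathlib formalisation cell (harness21).  Prover seat hodgecm-mathlib-K2Liu-p12 (g4): Track B «K2-LIT»,
#184♮ = hLiu418 = stmt-HodgeConjecture-24832; Road Φ of socket #41, Φ9 consumer sheet «G3-inst» (LEAD F0P6-plan (g14) BATCH #28 (1) ∕ #32 (4));
census `K2/K2Liu-p12/g4/CENSUS-G3inst-SkewCarrierBridge.K2Liu-p12-g4.md`.  File B4 (assembly).
-/
import Summits.HodgeConjecture.HodgeConjecture.Theorems.K2LiuUnipDeltaLocBridge                  -- ★ B1: `mem_unipDeltaLoc_iff_mem_unipDeltaLocal`, `trace_mul_toBlocks₁₂_component_nElem`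
import Summits.HodgeConjecture.HodgeConjecture.Theorems.K2LiuUnipDeltaLocalHaarTransport         -- ★ B2: `integral_eq_integral_nElem`, `map_apply_ball_zero_eq`
import Summits.HodgeConjecture.HodgeConjecture.Theorems.K2LiuSiegelUnipotentCharacterFactorisation -- ★ (d1): `unipDeltaChar_locToAdelic_eq_prod`, `map_adeleEval_eq_evalPlace`
import HarnessLib

/-!
# Crux `HLiu418`, Road Φ of socket #41, «G3-inst» ASSEMBLY — ROW G1's LOCAL FACTOR IS A SKEW-CARRIER INTEGRAL:
# `∫_{N_Δ(L⁺_v)} conj ψ_S(ι_v y)·g(y) dν_v = ∫_{Skew} g(n(t))·ψ(−τ tr(β t)) d(n^*ν_v)(t)`, `β = −½ S`, and `(w_Δ)_v` IS ★ D10's local Weyl element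

Cell `hodgecm-mathlib`, crux item hLiu418 = `stmt-HodgeConjecture-24832`, route of record `HCCMUnconditional`; squad K2 ∕ K2Liu, road `K2_Liu`,
socket #41 `sig_K2LiuSiegelEisensteinContinuation`, Road Φ; consumer = the Φ9 tie: ★ G1-close `K2LiuWhittakerDeltaEulerProduct.whittakerDelta_eq_mul_tprod_euler`
delivers the local factor off `T` as `∫ y : ↥(unipDeltaLoc v), conj ψ_S(ι_v y) · Λ_{s,v}((w_Δ)_v · y) ∂ν_v`, while ★ Φ4 (ii)(iii) ∕ ★ R1 `K2LiuGoodPlaceWhittakerNonUnimodular`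
∕ ★ E7 `K2LiuGoodPlaceWhittakerUnimodularValueCM` ∕ ★ Φ5-tie `K2LiuBadPlaceWhittakerEntire` are stated on the Skew carrier (`∫_{B(−k)} φ_s(w_Δ·n(t))·ψ(−τ tr(βt)) dμ(t)`,
★ D10's LOCAL `w_Δ`).  THEOREMS ONLY (no `def`, no `instance`, no `notation`, no named-fact hypothesis, no `sorry`); lane `--supports stmt-HodgeConjecture-24832`
(count-neutral helper; closes no socket by itself).

THE MATHEMATICS [Weil1965, §37], [Shimura1997, §18.1 (18.4)], [HarrisKudlaSweet1996, §1 (1.11)–(1.12)], [Kudla1994, §3].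
* §1 **`evalPlace_finPart_weylDelta`** — the `v`-component of the GLOBAL Weyl element ★ `SiegelDoubled.weylDelta` (`blk w_Δ = diag(1, −1)`, ★ `blk_weylDelta`) IS
  ★ D10's LOCAL `LocalSplitting.weylDelta` (adapted matrix `(0 1; 1 0)`, i.e. `R (0 1; 1 0) R⁻¹ = diag(1, −1)`) — so `Λ_{s,v}((w_Δ)_v · n(t))` is literally the
  `φ_s(w_Δ · n(t))` of the Skew-carrier files (★ `matA_injective`, ★ B1 `reindex_component_apply_eq_matA`, ★ (d1) `map_adeleEval_eq_evalPlace`).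
* §2 **`integral_unipDeltaLoc_eq_integral_skew`** — for the Fourier index `S ∈ M_n(L)`, ANY `g : H(L⁺_v) → ℂ`, any measure `ν` on `N_Δ(L⁺_v) = unipDeltaLoc v` and the
  coordinate homeomorphism `ψc : N_Δ(L⁺_v) ≃ₜ Skew` of ★ B2 (`(ψc u).1 = B(matA u)`; it EXISTS for `unipDeltaLoc v` by ★ B2 `exists_homeomorph_skew_of_carrier` + ★ B1
  `mem_unipDeltaLoc_iff_mem_unipDeltaLocal`):
  `∫ conj ψ_S(ι_v y)·g(y) dν(y) = ∫_{Skew} conj(∏_{w∣v} ψ_{L,w}(−½·tr((S⊗1)·t)_w)) · g(n(t)) d(ψc_*ν)(t)` (★ B2 `integral_eq_integral_nElem`; ★ (d1)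
  `unipDeltaChar_locToAdelic_eq_prod` at `y = n(t)` with ★ B1 `trace_mul_toBlocks₁₂_component_nElem`: `tr(S_w·X(n(t)_w)) = −½ tr(S t)_w`).
* §3 **`integral_unipDeltaLoc_eq_integral_skew_addChar`** — the same with the local characters bundled into ONE additive character of `L⁺_v` through the local
  trace, BY VALUE: given `ψ : AddChar L⁺_v 𝕊¹`, `τ : L ⊗ L⁺_v → L⁺_v` and the letter `hΨ : ∀ x, ∏_{w∣v} ψ_{L,w}(x_w) = ψ(τ x)` (Tate's local trace compatibility — brick B3
  `K2LiuTateCharacterLocalTrace`, the one remaining input):  `… = ∫_{Skew} g(n(t)) · ψ(−τ(tr(β·t))) d(ψc_*ν)(t)` with **`β := −⅟2 • (S ⊗ 1)`** —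
  EXACTLY the integrand `φ_s(w_Δ·n(t))·ψ(−τ tr(βt))` of ★ Φ4∕Φ5∕E7∕R1 (with `g := φ_s((w_Δ)_v · _)` and §1).  Together with ★ B2 `map_apply_ball_zero_eq` (`(ψc_*ν)(B 0) =
  ν(N_Δ ∩ K_v)`, = `1` under Φ3c's `hνK`) every Skew-carrier head plugs into row G1's Euler factor BY NAME.
HONEST LABEL.  Count-neutral helper; it retires nothing by itself: `HC_CM` is proved only modulo the 7 printed citations (2 remaining named inputs:
hLiu418 = `stmt-HodgeConjecture-24832`, h413 = `stmt-HodgeConjecture-24833`) until rung 0 closes.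

## References
* [Weil1965] A. Weil, *L'intégration dans les groupes topologiques* (2nd ed. 1965): §37.   * [Kudla1994] S. S. Kudla, Israel J. Math. 87 (1994): §3.
* [Shimura1997] G. Shimura, *Euler products and Eisenstein series*, CBMS 93 (1997): §18.1 (18.4), §18.3 (the local Whittaker integral and its character).
* [HarrisKudlaSweet1996] M. Harris, S. Kudla, W. J. Sweet, J. AMS 9 (1996): §1 (1.11)–(1.12).
* [CasselsFrohlichANT1967] J. Tate, in Cassels–Fröhlich (eds.), *Algebraic Number Theory* (1967), Ch. XV §2.2, §4.1 (local components of `ψ_L`, trace compatibility).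
-/

set_option autoImplicit false
-- the mandated namespace repeats the single-problem summit's segment (`HodgeConjecture.HodgeConjecture`)
set_option linter.dupNamespace false

noncomputable section

open scoped Matrix ComplexConjugate NNReal ENNReal
open NumberField IsDedekindDomain Matrix MeasureTheory
open Literature.NumberTheory.Automorphic Literature.NumberTheory.Automorphic.UnitaryGroup Literature.NumberTheory.GaloisRepresentations
open Literature.NumberTheory.GelbartRogawski1991 Literature.NumberTheory.GelbartRogawski1991.GRConstruction
open Literature.NumberTheory.GelbartRogawski1991.AdaptedBlocks
open Literature.NumberTheory.GelbartRogawski1991.UnitaryDualPair.LocalSplitting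
open Literature.NumberTheory.K2Lit Literature.NumberTheory.K2Lit.SiegelDoubled Literature.NumberTheory.K2Lit.LocalSiegelDoubled
open Summit.HodgeConjecture.HodgeConjecture.Cruxes.HLiu418.K2LiuSiegelUnipotentFourierDefs
open Summit.HodgeConjecture.HodgeConjecture.Cruxes.HLiu418.K2LiuSiegelUnipotentLocalDefs
open Summit.HodgeConjecture.HodgeConjecture.Cruxes.HLiu418.K2LiuSiegelUnipotentCharacterFactorisation
open Summit.HodgeConjecture.HodgeConjecture.Cruxes.HLiu418.K2LiuUnipDeltaLocBridge
open Summit.HodgeConjecture.HodgeConjecture.Cruxes.HLiu418.K2LiuUnipDeltaLocalHaarTransport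

namespace Summit.HodgeConjecture.HodgeConjecture.Cruxes.HLiu418.K2LiuLocalWhittakerFactorSkew

variable (L : Type) [Field L] [NumberField L] [IsCMField L]
variable {N M n : ℕ} (e : Fin N × Fin M ≃ Fin n)
  (dV : Fin N → L) (hdV : ∀ i, IsCMField.complexConj L (dV i) = dV i)
  (dW : Fin M → L) (hdW : ∀ i, IsCMField.complexConj L (dW i) = dW i)
  (v : HeightOneSpectrum (𝓞 (Fp L)))

/-! ## §1 `(w_Δ)_v` is ★ D10's local Weyl element -/

/-- `R (0 1; 1 0) R⁻¹ = diag(1, −1)` for `R = (1 1; 1 −1)`, `R⁻¹ = ½R` (any commutative ring with `⅟2`). [cite: HarrisKudlaSweet1996, §1 (1.11)] -/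
theorem cayR_mul_weylAd_mul_cayRinv {R ι : Type*} [CommRing R] [Invertible (2 : R)] [Fintype ι] [DecidableEq ι] :
    cayR R ι * Matrix.fromBlocks 0 1 1 0 * cayRinv R ι = Matrix.fromBlocks 1 0 0 (-1) := by
  have h2 : (⅟(2 : R)) • ((1 : Matrix ι ι R) + 1) = 1 := by
    rw [← two_smul R (1 : Matrix ι ι R), smul_smul, invOf_mul_self, one_smul]
  rw [cayRinv, Matrix.mul_smul, cayR, Matrix.fromBlocks_multiply, Matrix.fromBlocks_multiply, Matrix.fromBlocks_smul]
  simp only [Matrix.mul_one, Matrix.mul_zero, zero_add, add_zero, Matrix.mul_neg]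
  rw [show (1 : Matrix ι ι R) + -1 = 0 from add_neg_cancel 1, show (-1 : Matrix ι ι R) + 1 = 0 from neg_add_cancel 1, smul_zero,
    show (-1 : Matrix ι ι R) + -1 = -((1 : Matrix ι ι R) + 1) from (neg_add 1 1).symm, smul_neg, h2]

/-- **`(w_Δ)_v = ` ★ D10's `w_Δ`**: the `v`-component `evalPlace v (finPart w_Δ)` of the global Weyl element ★ `SiegelDoubled.weylDelta` (`blk w_Δ = diag(1,−1)`) is the
local ★ `LocalSplitting.weylDelta` of the D10 frame at the K2Lit datum (adapted matrix `(0 1; 1 0)`; both have the e₂-matrix `diag(1, −1)` at every `w ∣ v`,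
★ `matA_injective`). [cite: Kudla1994, §3] [cite: HarrisKudlaSweet1996, §1 (1.11)] -/
theorem evalPlace_finPart_weylDelta :
    UnitaryGroup.evalPlace (Fp L) L (IsCMField.complexConj L) (n + n) (hermD L e dV hdV dW hdW) v
        (UnitaryGroup.finPart (Fp L) L (IsCMField.complexConj L) (n + n) (hermD L e dV hdV dW hdW) (SiegelDoubled.weylDelta L e dV hdV dW hdW)) =
      UnitaryDualPair.LocalSplitting.weylDelta (Fp L) L (IsCMField.complexConj L) v n (hermD_eq_map_gramD L e dV hdV dW hdW) := by
  apply matA_injective (Fp L) L (IsCMField.complexConj L) v n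
  rw [UnitaryDualPair.LocalSplitting.weylDelta, matA_ofAdapted, cayR_mul_weylAd_mul_cayRinv]
  refine Matrix.ext fun p q => funext fun w => ?_
  rw [← reindex_component_apply_eq_matA L e dV hdV dW hdW v _ w p q, ← map_adeleEval_eq_evalPlace L e dV hdV dW hdW v (SiegelDoubled.weylDelta L e dV hdV dW hdW) w]
  have hblk := blk_weylDelta L e dV hdV dW hdW
  have hentry : (Matrix.reindex (GRConstruction.e₂ (n := n)).symm (GRConstruction.e₂ (n := n)).symm
      (((SiegelDoubled.weylDelta L e dV hdV dW hdW : HA L e dV hdV dW hdW) : GL (Fin (n + n)) (AdeleRing (𝓞 L) L)) :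
        Matrix (Fin (n + n)) (Fin (n + n)) (AdeleRing (𝓞 L) L))) p q = (Matrix.fromBlocks 1 0 0 (-1) : Matrix _ _ (AdeleRing (𝓞 L) L)) p q := by
    rw [← hblk]
  show AdelicGroupData.adeleEval L w.1 ((((SiegelDoubled.weylDelta L e dV hdV dW hdW : HA L e dV hdV dW hdW) : GL (Fin (n + n)) (AdeleRing (𝓞 L) L)) :
      Matrix (Fin (n + n)) (Fin (n + n)) (AdeleRing (𝓞 L) L)) (GRConstruction.e₂ (n := n) p) (GRConstruction.e₂ (n := n) q)) = _
  have hentry' : (((SiegelDoubled.weylDelta L e dV hdV dW hdW : HA L e dV hdV dW hdW) : GL (Fin (n + n)) (AdeleRing (𝓞 L) L)) :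
      Matrix (Fin (n + n)) (Fin (n + n)) (AdeleRing (𝓞 L) L)) (GRConstruction.e₂ (n := n) p) (GRConstruction.e₂ (n := n) q) =
        (Matrix.fromBlocks 1 0 0 (-1) : Matrix _ _ (AdeleRing (𝓞 L) L)) p q := hentry
  rw [hentry']
  rcases p with i | i <;> rcases q with j | j
  · rw [Matrix.fromBlocks_apply₁₁, Matrix.fromBlocks_apply₁₁, Matrix.one_apply, Matrix.one_apply]
    split_ifs
    · rw [map_one, Pi.one_apply]
    · rw [map_zero, Pi.zero_apply]
  · rw [Matrix.fromBlocks_apply₁₂, Matrix.fromBlocks_apply₁₂, Matrix.zero_apply, Matrix.zero_apply, map_zero, Pi.zero_apply]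
  · rw [Matrix.fromBlocks_apply₂₁, Matrix.fromBlocks_apply₂₁, Matrix.zero_apply, Matrix.zero_apply, map_zero, Pi.zero_apply]
  · rw [Matrix.fromBlocks_apply₂₂, Matrix.fromBlocks_apply₂₂, Matrix.neg_apply, Matrix.neg_apply, Matrix.one_apply, Matrix.one_apply]
    split_ifs
    · rw [map_neg, map_one, Pi.neg_apply, Pi.one_apply]
    · rw [neg_zero, neg_zero, map_zero, Pi.zero_apply]

/-! ## §2 Row G1's local factor is a Skew-carrier integral -/

section Skew

variable [MeasurableSpace ↥(unipDeltaLoc L e dV hdV dW hdW v)] [BorelSpace ↥(unipDeltaLoc L e dV hdV dW hdW v)]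
  (Sk : AddSubgroup (Matrix (Fin n) (Fin n) (LocalRing L v)))
  (hSk : ∀ t, t ∈ Sk ↔ (t.map (conjLocal L (IsCMField.complexConj L) v))ᵀ * gramS (Fp L) L v n (gramR L e dV hdV dW hdW) +
    gramS (Fp L) L v n (gramR L e dV hdV dW hdW) * t = 0)
  [MeasurableSpace Sk] [BorelSpace Sk]

omit [IsCMField L] in
/-- the principal adele of `x ∈ L` has `w`-component `x ∈ L_w` (inline copy of the folklore `adeleEval_algebraMap`, kept as a lemma on matrices:
`(S ⊗ 1)_w` read through the adeles or through `L ⊗ L⁺_v` is the same matrix). [folklore] -/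
theorem map_adeleEval_map_algebraMap (S : Matrix (Fin n) (Fin n) L) (w : UnitaryGroup.PlacesOver L v) :
    (S.map (algebraMap L (AdeleRing (𝓞 L) L))).map (AdelicGroupData.adeleEval L w.1) =
      (S.map (algebraMap L (LocalRing L v))).map (Pi.evalRingHom (fun w' : UnitaryGroup.PlacesOver L v => w'.1.adicCompletion L) w) := by
  refine Matrix.ext fun i j => ?_
  simp only [Matrix.map_apply, Pi.evalRingHom_apply, Pi.algebraMap_apply]
  rw [AdelicGroupData.adeleEval_apply]
  change algebraMap L (FiniteAdeleRing (𝓞 L) L) (S i j) w.1 = _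
  rw [FiniteAdeleRing.algebraMap_apply]
  exact adicCompletion_coe_eq_algebraMap (𝓞 L) L w.1 (S i j)

include hSk in
set_option maxHeartbeats 800000 in -- MEASURED (> 200 000): the K2Lit doubled unitary datum's binder telescope under `↥(unipDeltaLoc v) ≤ H(L⁺_v)` (as ★ (d2), same figure); plain `have`∕`refine`, no search tactics
/-- **ROW G1's LOCAL FACTOR IS A SKEW-CARRIER INTEGRAL.**  For the Fourier index `S ∈ M_n(L)`, any `g : H(L⁺_v) → ℂ` (read `y ↦ Λ_{s,v}((w_Δ)_v · y)`), any
measure `ν` on `N_Δ(L⁺_v) = unipDeltaLoc v` and the coordinate homeomorphism `ψc : N_Δ(L⁺_v) ≃ₜ Skew` with `(ψc u).1 = B(matA u)` (★ B2 + ★ B1):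
`∫ conj ψ_S(ι_v y) · g(y) dν(y) = ∫_{Skew} conj(∏_{w∣v} ψ_{L,w}(−(⅟2)_w · tr((S ⊗ 1)·t)_w)) · g(n(t)) d(ψc_*ν)(t)`.
[cite: Shimura1997, §18.1 (18.4)] [cite: Weil1965, §37] [cite: HarrisKudlaSweet1996, §1 (1.12)] -/
theorem integral_unipDeltaLoc_eq_integral_skew (ψc : ↥(unipDeltaLoc L e dV hdV dW hdW v) ≃ₜ Sk)
    (hψc : ∀ u, (ψc u).1 = blkB (matA (Fp L) L (IsCMField.complexConj L) v n
      (u : UnitaryGroup.localPi L (IsCMField.complexConj L) (n + n) (hermD L e dV hdV dW hdW) v)))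
    (ν : Measure ↥(unipDeltaLoc L e dV hdV dW hdW v)) (S : Matrix (Fin n) (Fin n) L)
    (g : UnitaryGroup.localPi L (IsCMField.complexConj L) (n + n) (hermD L e dV hdV dW hdW) v → ℂ) :
    ∫ y, conj ((unipDeltaChar L e dV hdV dW hdW S (locToAdelic L e dV hdV dW hdW v
        (y : UnitaryGroup.localPi L (IsCMField.complexConj L) (n + n) (hermD L e dV hdV dW hdW) v)) : Circle) : ℂ) *
      g (y : UnitaryGroup.localPi L (IsCMField.complexConj L) (n + n) (hermD L e dV hdV dW hdW) v) ∂ν =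
    ∫ t, conj ((∏ w : UnitaryGroup.PlacesOver L v, (adeleAddChar L).adicComponent w.1
        (-((⅟(2 : LocalRing L v)) w * (Matrix.trace (S.map (algebraMap L (LocalRing L v)) * t.1)) w)) : Circle) : ℂ) *
      g (nElem (Fp L) L (IsCMField.complexConj L) v n (hermD_eq_map_gramD L e dV hdV dW hdW) t.1 ((hSk t.1).1 t.2)) ∂(Measure.map ψc ν) := by
  have hN := mem_unipDeltaLoc_iff_mem_unipDeltaLocal L e dV hdV dW hdW v
  have h := integral_eq_integral_nElem (Fp L) L (IsCMField.complexConj L) v n (hermD_eq_map_gramD L e dV hdV dW hdW) hN hSk ψc hψc ν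
    (G := ℂ) (fun y => conj ((unipDeltaChar L e dV hdV dW hdW S (locToAdelic L e dV hdV dW hdW v y) : Circle) : ℂ) * g y)
  refine h.trans ?_
  refine integral_congr_ae (Filter.Eventually.of_forall fun t => ?_)
  have hchar : unipDeltaChar L e dV hdV dW hdW S (locToAdelic L e dV hdV dW hdW v
      (nElem (Fp L) L (IsCMField.complexConj L) v n (hermD_eq_map_gramD L e dV hdV dW hdW) t.1 ((hSk t.1).1 t.2))) =
      ∏ w : UnitaryGroup.PlacesOver L v, (adeleAddChar L).adicComponent w.1
        (-((⅟(2 : LocalRing L v)) w * (Matrix.trace (S.map (algebraMap L (LocalRing L v)) * t.1)) w)) := by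
    rw [unipDeltaChar_locToAdelic_eq_prod]
    refine Finset.prod_congr rfl fun w _ => ?_
    rw [map_adeleEval_map_algebraMap L v S w,
      trace_mul_toBlocks₁₂_component_nElem (Fp L) L (IsCMField.complexConj L) v n (hermD_eq_map_gramD L e dV hdV dW hdW) ((hSk t.1).1 t.2) w]
  simp only
  rw [hchar]

/-! ## §3 The same with the local trace letter `hΨ` (Tate) by value: the integrand of ★ Φ4∕Φ5∕E7∕R1 -/

include hSk in
set_option maxHeartbeats 800000 in -- MEASURED (> 200 000): same binder telescope as `integral_unipDeltaLoc_eq_integral_skew`; plain `refine`, no search tactics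
/-- **ROW G1's LOCAL FACTOR IN THE CURRENCY OF THE SKEW-CARRIER FILES.**  With the local characters bundled through the local trace BY VALUE —
`ψ : AddChar L⁺_v 𝕊¹`, `τ : L ⊗ L⁺_v → L⁺_v`, and the letter `hΨ : ∏_{w∣v} ψ_{L,w}(x_w) = ψ(τ x)` (Tate's local trace compatibility, brick B3) —
and `β := −⅟2 • (S ⊗ 1)`:  `∫ conj ψ_S(ι_v y)·g(y) dν(y) = ∫_{Skew} g(n(t)) · ψ(−τ(tr(β·t))) d(ψc_*ν)(t)`, the integrand `φ_s(w_Δ·n(t))·ψ(−τ tr(βt))` of ★ Φ4 (ii)(iii) ∕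
★ R1 ∕ ★ E7 ∕ ★ Φ5-tie for `g := φ_s((w_Δ)_v · _)` (§1: `(w_Δ)_v` = the local `w_Δ`). [cite: Shimura1997, §18.1 (18.4)] [cite: CasselsFrohlichANT1967, Ch. XV §2.2] [cite: Weil1965, §37] -/
theorem integral_unipDeltaLoc_eq_integral_skew_addChar (ψc : ↥(unipDeltaLoc L e dV hdV dW hdW v) ≃ₜ Sk)
    (hψc : ∀ u, (ψc u).1 = blkB (matA (Fp L) L (IsCMField.complexConj L) v n
      (u : UnitaryGroup.localPi L (IsCMField.complexConj L) (n + n) (hermD L e dV hdV dW hdW) v)))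
    (ν : Measure ↥(unipDeltaLoc L e dV hdV dW hdW v)) (S : Matrix (Fin n) (Fin n) L)
    (g : UnitaryGroup.localPi L (IsCMField.complexConj L) (n + n) (hermD L e dV hdV dW hdW) v → ℂ)
    {ψ : AddChar (v.adicCompletion (Fp L)) Circle} {τ : LocalRing L v → v.adicCompletion (Fp L)}
    (hΨ : ∀ x : LocalRing L v, (∏ w : UnitaryGroup.PlacesOver L v, (adeleAddChar L).adicComponent w.1 (x w)) = ψ (τ x)) :
    ∫ y, conj ((unipDeltaChar L e dV hdV dW hdW S (locToAdelic L e dV hdV dW hdW v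
        (y : UnitaryGroup.localPi L (IsCMField.complexConj L) (n + n) (hermD L e dV hdV dW hdW) v)) : Circle) : ℂ) *
      g (y : UnitaryGroup.localPi L (IsCMField.complexConj L) (n + n) (hermD L e dV hdV dW hdW) v) ∂ν =
    ∫ t, g (nElem (Fp L) L (IsCMField.complexConj L) v n (hermD_eq_map_gramD L e dV hdV dW hdW) t.1 ((hSk t.1).1 t.2)) *
      ((ψ (-τ (Matrix.trace ((-(⅟(2 : LocalRing L v) • S.map (algebraMap L (LocalRing L v)))) * t.1))) : Circle) : ℂ) ∂(Measure.map ψc ν) := by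
  refine (integral_unipDeltaLoc_eq_integral_skew L e dV hdV dW hdW v Sk hSk ψc hψc ν S g).trans ?_
  refine integral_congr_ae (Filter.Eventually.of_forall fun t => ?_)
  simp only
  rw [mul_comm]
  congr 1
  -- the argument `−⅟2 · tr((S⊗1)t)` as an element of `L ⊗ L⁺_v`
  set x : LocalRing L v := -(⅟(2 : LocalRing L v) * Matrix.trace (S.map (algebraMap L (LocalRing L v)) * t.1)) with hx
  have hprod : (∏ w : UnitaryGroup.PlacesOver L v, (adeleAddChar L).adicComponent w.1
      (-((⅟(2 : LocalRing L v)) w * (Matrix.trace (S.map (algebraMap L (LocalRing L v)) * t.1)) w))) = ψ (τ x) := by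
    rw [← hΨ x]
    refine Finset.prod_congr rfl fun w _ => ?_
    rw [hx, Pi.neg_apply, Pi.mul_apply]
  have htr : Matrix.trace ((-(⅟(2 : LocalRing L v) • S.map (algebraMap L (LocalRing L v)))) * t.1) = x := by
    rw [hx, Matrix.neg_mul, Matrix.trace_neg, Matrix.smul_mul, Matrix.trace_smul, smul_eq_mul]
  rw [hprod, htr, AddChar.map_neg_eq_inv, Circle.coe_inv_eq_conj]

end Skew

end Summit.HodgeConjecture.HodgeConjecture.Cruxes.HLiu418.K2LiuLocalWhittakerFactorSkew

end
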